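import Mathlib
import Summits.NavierStokesRegularity.NavierStokesRegularity.Theorems.EulerZoomLiouvillePowerGaugeEulerLiouvilleNeedleStayClock
import Summits.NavierStokesRegularity.NavierStokesRegularity.Theorems.EulerZoomLiouvillePowerGaugeEulerLiouvilleNeedleFeedingPerLabel
import Summits.NavierStokesRegularity.NavierStokesRegularity.Theorems.EulerZoomLiouvillePowerGaugeEulerLiouvilleNeedleFeedingLabels
import HarnessLib.Audit

/-!
# Crux E `EulerZoomLiouville.PowerGaugeEulerLiouville` — the needle stratum: TOOLS FOR THE FEEDING-TIME
# RACE (ROUND-37 §1 (R)): the vortical blob, the STAY half, the EXIT half, the exponent race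

Route №10 `EulerZoomLiouville` (NavierStokesRegularity), crux E = stmt-NavierStokesRegularity-19832,
registered residue `stub_selfSimilarC2Needle`, memo ROUND-37 of the cell `ns-regularity-ideate`
(text custody nsreg-p2), step **(R)**, first file (helpers; the race itself is
`…NeedleRace.curl_eq_zero_of_thinFastExits` in the sequel).  The three landed laws of the race are put in
the form the race consumes:

* `exists_vortical_ball` — THE BLOB: if `curl U x₀ ≠ 0` for an axisymmetric swirl-free `C²` field then
  `x₀` is off the axis (`curl_eq_zero_of_cylRadius_eq_zero`: `Ω = ξ•J`, `‖J‖ = r⊥`) and a small ball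
  around it carries `r⊥ > 0`, `‖Ω‖ ≥ ξ₀ r⊥` (`ξ₀ > 0`);
* `volume_stay_le` — THE STAY HALF: the labels of a vortical blob `B₀` whose backward similarity orbit
  (of the LEAD's cut-off field `V = U` on `‖·‖ < R_big`) STAYS in `‖·‖ ≤ 2R` on `[0, S]` have volume
  `≤ √(32·2R·B) ξ₀⁻¹ e^{−(1−2γ)S}`, `B ≥ ∫_{B̄_{2R}} ‖Ω‖²` — the stay-set clock law t38e
  (`NeedleStayClock.volume_image_toReal_le_of_stay`) applied to their positions a time `S` ago
  (`Φ_S '' (Φ_S ⁻¹' St) = St`, `isClosed_backwardStay`);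
* `ofReal_mul_volume_exit_le` — THE EXIT HALF: the labels of `B₀ ⊆ B̄_R` whose backward orbit does NOT
  stay satisfy `(|G|/(4R))·|X| ≤ (c_S|N|)^{½}(c_S ∫_N‖U‖²)^{½}`, `c_S = (e^{3γS}−1)/(3γ)`, for every
  measurable `G ⊆ [R², 4R²]` and tube `N ⊆ B̄_{2R}` with LEMMA K (`‖z‖² ∈ G → ⟪U z, z⟫ + γ‖z‖² < 0 → z ∈ N`)
  — the per-label law t38f (`NeedleFeeding.volume_toReal_le_feeding_of_exit`, orbit `Y s = Φ_{−s} y`,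
  Lemma K transferred to the cut-off field on `‖z‖ ≤ 2R`) fed to the label integration t38g
  (`NeedleFeeding.ofReal_mul_volume_le_feeding`, `L = 2R`, `∫_N ‖V‖² = ∫_N ‖U‖²`);
  `toReal_le_of_feeding` is the `ℝ≥0∞ → ℝ` bookkeeping `|X| ≤ c_S √ε / g` under `|N|·∫_N‖U‖² ≤ ε`;
* `race_arith` — THE EXPONENT RACE: with `S = s₁ log R`, `s₁ = ((1+q)/2 + 1)/(1−2γ)`, `m = 6γs₁ + 2`,
  the stay bound is `K₃/R` and the exit bound `≤ 4/(3γκR²)`, both `≤ v₀/4` for `R ≥ R⋆` (exp/log only).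

NOT NS, not E; 19832 OPEN.  References: Constantin–Ignatova–Vicol arXiv:2602.17570 §3.4.1
(3.21)–(3.22), §3.5 [ConstantinIgnatovaVicol2026Putative]; KNSS 2009 Remark 5.1 (`ω_θ/r`)
[KochNadirashviliSereginSverak2009]; (Cauchy–Schwarz, exp beats powers) [folklore].
-/

noncomputable section

-- the summit and its single problem share the name `NavierStokesRegularity` (D-0017 nested layout)
set_option linter.dupNamespace false

open Set Filter Topology Metric Function MeasureTheory InnerProductSpace
open scoped RealInnerProductSpace NNReal ENNReal

namespace Summit.NavierStokesRegularity.NavierStokesRegularity.Theorems.PowerGaugeEulerLiouville.NeedleRace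

open Literature.Analysis Literature.Analysis.FluidPDE
open Summit.NavierStokesRegularity.NavierStokesRegularity.Theorems.PowerGaugeEulerLiouville

variable {γ : ℝ} {U V : EuclideanSpace ℝ (Fin 3) → EuclideanSpace ℝ (Fin 3)}
  {P : EuclideanSpace ℝ (Fin 3) → ℝ}

/-! ### The vortical blob -/

/-- An axisymmetric swirl-free `C²` field has no vorticity on the axis: `Ω(y) = ξ • J(y)` and
`‖J(y)‖ = r⊥(y) = 0` there. [cite: KochNadirashviliSereginSverak2009, §5 Remark 5.1] -/
theorem curl_eq_zero_of_cylRadius_eq_zero (hU : ContDiff ℝ 2 U) (hax : IsAxisymmetric U)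
    (hsw : HasNoSwirl U) {y : EuclideanSpace ℝ (Fin 3)} (hy : cylRadius y = 0) : curl U y = 0 := by
  obtain ⟨ξ, hξ⟩ := NeedleCasimirClock.exists_curl_eq_smul_rotGen hax hsw hU y
  have h0 : rotGen y = 0 := by
    rw [← norm_eq_zero, norm_rotGen_eq_cylRadius', hy]
  rw [hξ, h0, smul_zero]

/-- **The vortical blob.** If `curl U x₀ ≠ 0` (`U` axisymmetric swirl-free `C²`) then `x₀` is off the axis
and on a small ball around it `r⊥ > 0` and `‖Ω‖ ≥ ξ₀ r⊥` for some `ξ₀ > 0` (continuity). [folklore] -/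
theorem exists_vortical_ball (hU : ContDiff ℝ 2 U) (hax : IsAxisymmetric U) (hsw : HasNoSwirl U)
    {x₀ : EuclideanSpace ℝ (Fin 3)} (hx₀ : curl U x₀ ≠ 0) :
    ∃ ξ₀ r : ℝ, 0 < ξ₀ ∧ 0 < r ∧ r ≤ 1 ∧
      ∀ y ∈ ball x₀ r, 0 < cylRadius y ∧ ξ₀ * cylRadius y ≤ ‖curl U y‖ := by
  have hcont : Continuous (curl U) := (differentiable_curl_of_contDiff hU).continuous
  have hρ₀ : 0 < cylRadius x₀ := by
    rcases (cylRadius_nonneg x₀).eq_or_lt with h | h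
    · exact absurd (curl_eq_zero_of_cylRadius_eq_zero hU hax hsw h.symm) hx₀
    · exact h
  have hn₀ : 0 < ‖curl U x₀‖ := norm_pos_iff.2 hx₀
  set ξ₀ : ℝ := ‖curl U x₀‖ / (2 * cylRadius x₀) with hξ₀def
  have hξ₀ : 0 < ξ₀ := by positivity
  have hξ₀eq : ξ₀ * cylRadius x₀ = ‖curl U x₀‖ / 2 := by
    rw [hξ₀def]; field_simp
  set f : EuclideanSpace ℝ (Fin 3) → ℝ := fun y => ‖curl U y‖ - ξ₀ * cylRadius y with hf
  have hfc : Continuous f := hcont.norm.sub (continuous_const.mul continuous_cylRadius)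
  have hfx₀ : 0 < f x₀ := by simp only [hf]; rw [hξ₀eq]; linarith
  have hev₁ : ∀ᶠ y in 𝓝 x₀, 0 < f y := (hfc.tendsto x₀).eventually_const_lt hfx₀
  have hev₂ : ∀ᶠ y in 𝓝 x₀, 0 < cylRadius y := (continuous_cylRadius.tendsto x₀).eventually_const_lt hρ₀
  obtain ⟨ε, hε, hball⟩ := Metric.eventually_nhds_iff_ball.1 (hev₁.and hev₂)
  refine ⟨ξ₀, min ε 1, hξ₀, by positivity, min_le_right _ _, fun y hy => ?_⟩
  have hy' : y ∈ ball x₀ ε := ball_subset_ball (min_le_left _ _) hy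
  obtain ⟨h1, h2⟩ := hball y hy'
  refine ⟨h2, ?_⟩
  simp only [hf] at h1
  linarith

/-! ### The STAY half: the clock law on the lingering labels -/

/-- The backward STAY set `{y : ∀ σ ∈ [0,S], ‖Ψ_{−σ} y‖ ≤ L}` is closed. [folklore] -/
theorem isClosed_backwardStay (hV : ContDiff ℝ 2 V) {K : ℝ} (hK : ∀ y, ‖fderiv ℝ V y‖ ≤ K) (S L : ℝ) :
    IsClosed {y : EuclideanSpace ℝ (Fin 3) |
      ∀ σ ∈ Icc 0 S, ‖ODE.evolutionMap (fun _ : ℝ => selfSimilarTransport γ 0 V) 0 (-σ) y‖ ≤ L} := by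
  have heq : {y : EuclideanSpace ℝ (Fin 3) |
      ∀ σ ∈ Icc 0 S, ‖ODE.evolutionMap (fun _ : ℝ => selfSimilarTransport γ 0 V) 0 (-σ) y‖ ≤ L} =
      ⋂ σ ∈ Icc (0 : ℝ) S,
        {y | ‖ODE.evolutionMap (fun _ : ℝ => selfSimilarTransport γ 0 V) 0 (-σ) y‖ ≤ L} := by
    ext y; simp only [mem_setOf_eq, mem_iInter]
  rw [heq]
  refine isClosed_biInter fun σ _ => isClosed_le ?_ continuous_const
  exact (C2.Kelvin.contDiff_flow (γ := γ) hV hK (-σ)).continuous.norm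

/-- **STAY half of the race.** `(U,P)` an axisymmetric swirl-free `C²` profile, `V` the cut-off copy
(`= U` on `‖·‖ < R_big`, `2R < R_big`), `B₀` a measurable blob with `r⊥ > 0`, `‖Ω‖ ≥ ξ₀ r⊥` on it,
`∫_{B̄_{2R}} ‖Ω‖² ≤ B`.  Then the labels of `B₀` whose backward orbit stays in `‖·‖ ≤ 2R` on `[0,S]` have
volume `≤ √(32·2R·B) ξ₀⁻¹ e^{−(1−2γ)S}` (t38e applied to their positions a time `S` ago).
[cite: ConstantinIgnatovaVicol2026Putative, §3.4.1 eq. (3.21)-(3.22)] -/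
theorem volume_stay_le (hprof : IsSelfSimilarEulerProfile γ 0 U P) (hax : IsAxisymmetric U)
    (hsw : HasNoSwirl U) (hV2 : ContDiff ℝ 2 V) {K : ℝ} (hK : ∀ y, ‖fderiv ℝ V y‖ ≤ K)
    {R Rbig : ℝ} (hR : 0 < R) (hRbig : 2 * R < Rbig)
    (hVU : ∀ w ∈ ball (0 : EuclideanSpace ℝ (Fin 3)) Rbig, V w = U w) {S : ℝ} (hS : 0 ≤ S)
    {B₀ : Set (EuclideanSpace ℝ (Fin 3))} (hB₀m : MeasurableSet B₀) {ξ₀ : ℝ} (hξ₀ : 0 < ξ₀)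
    (hvort : ∀ y ∈ B₀, 0 < cylRadius y ∧ ξ₀ * cylRadius y ≤ ‖curl U y‖)
    {B : ℝ} (hB : ∫ z in closedBall (0 : EuclideanSpace ℝ (Fin 3)) (2 * R), ‖curl U z‖ ^ 2 ≤ B) :
    (volume (B₀ ∩ {y | ∀ σ ∈ Icc 0 S,
        ‖ODE.evolutionMap (fun _ : ℝ => selfSimilarTransport γ 0 V) 0 (-σ) y‖ ≤ 2 * R})).toReal ≤
      Real.sqrt (32 * (2 * R) * B) / ξ₀ * Real.exp (-((1 - 2 * γ) * S)) := by
  set Φ := ODE.evolutionMap (fun _ : ℝ => selfSimilarTransport γ 0 V) 0 with hΦ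
  have hV1 : ContDiff ℝ 1 V := hV2.of_le (by norm_num)
  set St : Set (EuclideanSpace ℝ (Fin 3)) := B₀ ∩ {y | ∀ σ ∈ Icc 0 S, ‖Φ (-σ) y‖ ≤ 2 * R} with hSt
  have hStm : MeasurableSet St := hB₀m.inter (isClosed_backwardStay (γ := γ) hV2 hK S (2 * R)).measurableSet
  -- the positions a time `S` ago
  set A : Set (EuclideanSpace ℝ (Fin 3)) := Φ S ⁻¹' St with hA
  have hΦSc : Continuous (Φ S) := (C2.Kelvin.contDiff_flow (γ := γ) hV2 hK S).continuous
  have hAm : MeasurableSet A := hΦSc.measurable hStm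
  have hflow_add : ∀ (s t : ℝ) (y : EuclideanSpace ℝ (Fin 3)), Φ (s + t) y = Φ s (Φ t y) :=
    fun s t y => C2.Kelvin.flow_add (γ := γ) hV1 hK s t y
  have hΦinv : ∀ y, Φ S (Φ (-S) y) = y := by
    intro y
    have h1 := hflow_add S (-S) y
    rw [add_neg_cancel] at h1
    rw [← h1]; exact ODE.evolutionMap_self _ 0 y
  have himage : Φ S '' A = St := by
    ext y
    constructor
    · rintro ⟨z, hz, rfl⟩; exact hz
    · intro hy
      exact ⟨Φ (-S) y, by show Φ S (Φ (-S) y) ∈ St; rw [hΦinv y]; exact hy, hΦinv y⟩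
  -- forward orbits of `A` stay in the ball on `[0,S]`
  have hstay : ∀ a ∈ A, ∀ σ ∈ Icc 0 S, ‖Φ σ a‖ ≤ 2 * R := by
    intro a ha σ hσ
    have hy : Φ S a ∈ St := ha
    have h1 : Φ σ a = Φ (-(S - σ)) (Φ S a) := by
      rw [← hflow_add]; congr 1; ring
    rw [h1]
    exact hy.2 (S - σ) ⟨by linarith [hσ.2], by linarith [hσ.1]⟩
  -- end points are vortical off the axis
  have hvort' : ∀ a ∈ A, 0 < cylRadius (Φ S a) ∧ ξ₀ * cylRadius (Φ S a) ≤ ‖curl U (Φ S a)‖ :=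
    fun a ha => hvort (Φ S a) (show Φ S a ∈ St from ha).1
  have hint : IntegrableOn (fun z => ‖curl U z‖ ^ 2) (closedBall (0 : EuclideanSpace ℝ (Fin 3)) (2 * R)) :=
    (((differentiable_curl_of_contDiff hprof.contDiff_velocity).continuous.norm.pow 2).continuousOn.integrableOn_compact
      (isCompact_closedBall 0 (2 * R)))
  have h2R : 0 < 2 * R := by positivity
  have hmain := NeedleStayClock.volume_image_toReal_le_of_stay (γ := γ) hprof hax hsw hV2 hK h2R hRbig hVU hS
    hAm hstay hξ₀ hvort' hint hB
  rw [himage] at hmain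
  exact hmain

/-! ### The EXIT half: the feeding law on the escaping labels -/

/-- `ℝ≥0∞` bookkeeping: `g·|X| ≤ (c|N|)^{½} (c J)^{½}` and `|N|·J ≤ ε` give `|X| ≤ c √ε / g`. [folklore] -/
theorem toReal_le_of_feeding {g c ε : ℝ} (hg : 0 < g) (hc : 0 ≤ c) (hε : 0 ≤ ε)
    {X N : Set (EuclideanSpace ℝ (Fin 3))} {J : ℝ≥0∞}
    (h : ENNReal.ofReal g * volume X ≤
      (ENNReal.ofReal c * volume N) ^ (1 / 2 : ℝ) * (ENNReal.ofReal c * J) ^ (1 / 2 : ℝ))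
    (hthin : volume N * J ≤ ENNReal.ofReal ε) :
    (volume X).toReal ≤ c * Real.sqrt ε / g := by
  have h1 : (ENNReal.ofReal c * volume N) ^ (1 / 2 : ℝ) * (ENNReal.ofReal c * J) ^ (1 / 2 : ℝ) ≤
      ENNReal.ofReal (c * Real.sqrt ε) := by
    rw [← ENNReal.mul_rpow_of_nonneg _ _ (by norm_num : (0 : ℝ) ≤ 1 / 2)]
    have h2 : ENNReal.ofReal c * volume N * (ENNReal.ofReal c * J) =
        ENNReal.ofReal c * ENNReal.ofReal c * (volume N * J) := by ring
    rw [h2]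
    calc (ENNReal.ofReal c * ENNReal.ofReal c * (volume N * J)) ^ (1 / 2 : ℝ)
        ≤ (ENNReal.ofReal c * ENNReal.ofReal c * ENNReal.ofReal ε) ^ (1 / 2 : ℝ) := by
          gcongr
      _ = ENNReal.ofReal (c * Real.sqrt ε) := by
          rw [← ENNReal.ofReal_mul hc, ← ENNReal.ofReal_mul (mul_nonneg hc hc),
            ENNReal.ofReal_rpow_of_nonneg (by positivity) (by norm_num)]
          congr 1
          rw [show c * c * ε = (c * Real.sqrt ε) ^ 2 by
            rw [mul_pow, Real.sq_sqrt hε]; ring]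
          rw [← Real.sqrt_eq_rpow, Real.sqrt_sq (by positivity)]
  have h3 : ENNReal.ofReal g * volume X ≤ ENNReal.ofReal (c * Real.sqrt ε) := h.trans h1
  have hg' : ENNReal.ofReal g ≠ 0 := by
    rw [ne_eq, ENNReal.ofReal_eq_zero, not_le]; exact hg
  have h4 : volume X ≤ ENNReal.ofReal (c * Real.sqrt ε) / ENNReal.ofReal g := by
    rw [ENNReal.le_div_iff_mul_le (Or.inl hg') (Or.inl ENNReal.ofReal_ne_top), mul_comm]
    exact h3
  have h5 := ENNReal.toReal_mono (ENNReal.div_lt_top ENNReal.ofReal_ne_top hg').ne h4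
  rw [ENNReal.toReal_div, ENNReal.toReal_ofReal (by positivity), ENNReal.toReal_ofReal hg.le] at h5
  exact h5

/-- **EXIT half of the race.** `V` the cut-off copy of `U` (`= U` on `‖·‖ < R_big`, `2R < R_big`; `V ∈ C²`,
`‖DV‖ ≤ K`, divergence-free on `‖·‖ ≤ 2R`), `B₀ ⊆ B̄_R` a measurable blob, `G ⊆ [R², 4R²]` measurable good
squared radii, `N ⊆ B̄_{2R}` a measurable tube with LEMMA K: `‖z‖² ∈ G → ⟪U z, z⟫ + γ‖z‖² < 0 → z ∈ N`.
Then the labels of `B₀` whose backward orbit does NOT stay in `‖·‖ ≤ 2R` on `[0,S]` satisfy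
`(|G|/(4R))·|X| ≤ (c_S |N|)^{½} (c_S ∫_N ‖U‖²)^{½}`, `c_S = (e^{3γS} − 1)/(3γ)` (t38f on each label, t38g across
labels). [cite: ConstantinIgnatovaVicol2026Putative, §3.5 (first exits are fast)] -/
theorem ofReal_mul_volume_exit_le (hV2 : ContDiff ℝ 2 V) {K : ℝ} (hK : ∀ y, ‖fderiv ℝ V y‖ ≤ K)
    (hγ : 0 < γ) {R Rbig : ℝ} (hR : 0 < R) (hRbig : 2 * R < Rbig)
    (hVU : ∀ w ∈ ball (0 : EuclideanSpace ℝ (Fin 3)) Rbig, V w = U w)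
    (hdiv : ∀ z : EuclideanSpace ℝ (Fin 3), ‖z‖ ≤ 2 * R → VectorCalculus.divergence V z = 0)
    {S : ℝ} (hS : 0 ≤ S)
    {B₀ : Set (EuclideanSpace ℝ (Fin 3))} (hB₀m : MeasurableSet B₀)
    (hB₀R : B₀ ⊆ closedBall (0 : EuclideanSpace ℝ (Fin 3)) R)
    {G : Set ℝ} (hGm : MeasurableSet G) (hG : G ⊆ Icc (R ^ 2) ((2 * R) ^ 2))
    {N : Set (EuclideanSpace ℝ (Fin 3))} (hNm : MeasurableSet N)
    (hNsub : N ⊆ closedBall (0 : EuclideanSpace ℝ (Fin 3)) (2 * R))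
    (hLemK : ∀ z : EuclideanSpace ℝ (Fin 3), ‖z‖ ^ 2 ∈ G → ⟪U z, z⟫ + γ * ‖z‖ ^ 2 < 0 → z ∈ N) :
    ENNReal.ofReal ((volume G).toReal / (4 * R)) *
        volume (B₀ \ {y | ∀ σ ∈ Icc 0 S,
          ‖ODE.evolutionMap (fun _ : ℝ => selfSimilarTransport γ 0 V) 0 (-σ) y‖ ≤ 2 * R}) ≤
      (ENNReal.ofReal ((Real.exp (3 * γ * S) - 1) / (3 * γ)) * volume N) ^ (1 / 2 : ℝ) *
        (ENNReal.ofReal ((Real.exp (3 * γ * S) - 1) / (3 * γ)) *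
          ∫⁻ z in N, ENNReal.ofReal (‖U z‖ ^ 2)) ^ (1 / 2 : ℝ) := by
  set Φ := ODE.evolutionMap (fun _ : ℝ => selfSimilarTransport γ 0 V) 0 with hΦ
  have hV1 : ContDiff ℝ 1 V := hV2.of_le (by norm_num)
  have hVc : Continuous V := hV2.continuous
  set X : Set (EuclideanSpace ℝ (Fin 3)) := B₀ \ {y | ∀ σ ∈ Icc 0 S, ‖Φ (-σ) y‖ ≤ 2 * R} with hX
  have hXm : MeasurableSet X := hB₀m.diff (isClosed_backwardStay (γ := γ) hV2 hK S (2 * R)).measurableSet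
  -- `V = U` on the tube and on the good spheres
  have hVU' : ∀ z : EuclideanSpace ℝ (Fin 3), ‖z‖ ≤ 2 * R → V z = U z :=
    fun z hz => hVU z (mem_ball_zero_iff.2 (lt_of_le_of_lt hz hRbig))
  have hJ : ∫⁻ z in N, ENNReal.ofReal (‖V z‖ ^ 2) = ∫⁻ z in N, ENNReal.ofReal (‖U z‖ ^ 2) := by
    refine setLIntegral_congr_fun hNm (fun z hz => ?_)
    rw [hVU' z (mem_closedBall_zero_iff.1 (hNsub hz))]
  -- Lemma K for the cut-off field
  have hLemKV : ∀ z : EuclideanSpace ℝ (Fin 3), ‖z‖ ^ 2 ∈ G → ⟪V z, z⟫ + γ * ‖z‖ ^ 2 < 0 → z ∈ N := by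
    intro z hzG hfast
    have hz2R : ‖z‖ ≤ 2 * R := by
      have h1 : ‖z‖ ^ 2 ≤ (2 * R) ^ 2 := (hG hzG).2
      exact (abs_le_of_sq_le_sq' h1 (by positivity)).2
    rw [hVU' z hz2R] at hfast
    exact hLemK z hzG hfast
  -- the per-label law on every exiting label
  have hlabel : ∀ y ∈ X, (volume G).toReal / (4 * R) ≤
      Real.sqrt (∫ s in Icc 0 S,
        ({s : ℝ | ∀ σ ∈ Icc 0 s, ‖Φ (-σ) y‖ ≤ 2 * R} ∩ (fun s => Φ (-s) y) ⁻¹' N).indicator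
          (fun _ => (1 : ℝ)) s) *
      Real.sqrt (∫ s in Icc 0 S,
        ({s : ℝ | ∀ σ ∈ Icc 0 s, ‖Φ (-σ) y‖ ≤ 2 * R} ∩ (fun s => Φ (-s) y) ⁻¹' N).indicator
          (fun s => ‖V (Φ (-s) y)‖ ^ 2) s) := by
    intro y hy
    set Y : ℝ → EuclideanSpace ℝ (Fin 3) := fun s => Φ (-s) y with hYdef
    have hY : ∀ s, HasDerivAt Y (-(selfSimilarTransport γ 0 V (Y s))) s := by
      intro s
      have h1 := C2.Kelvin.hasDerivAt_flow_neg (γ := γ) hV1 hK y s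
      rw [neg_one_smul] at h1
      exact h1
    have hY0 : Y 0 = y := by simp [hYdef, hΦ, ODE.evolutionMap_self]
    have h0 : ‖Y 0‖ ≤ R := by rw [hY0]; exact mem_closedBall_zero_iff.1 (hB₀R hy.1)
    have hexit : ∃ s ∈ Icc 0 S, 2 * R ≤ ‖Y s‖ := by
      have h1 : ¬ ∀ σ ∈ Icc 0 S, ‖Φ (-σ) y‖ ≤ 2 * R := hy.2
      push Not at h1
      obtain ⟨σ, hσ, hlt⟩ := h1
      exact ⟨σ, hσ, hlt.le⟩
    have hmain := NeedleFeeding.volume_toReal_le_feeding_of_exit (γ := γ) (N := N) (G := G) hVc hγ.le hR hY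
      h0 hexit hNm hGm hG hLemKV
    have h4R : 0 < 4 * R := by positivity
    rw [div_le_iff₀ h4R]
    calc (volume G).toReal ≤ _ := hmain
      _ = _ := by ring
  have hfeed := NeedleFeeding.ofReal_mul_volume_le_feeding (γ := γ) (L := 2 * R) (N := N) hV2 hK hγ hdiv hNm
    hXm hS hlabel
  rw [hJ] at hfeed
  exact hfeed


/-! ### The exponent race (pure real analysis) -/

/-- **THE EXPONENT RACE.**  With `S = s₁ log R`, `s₁ = ((1+q)/2 + 1)/(1−2γ)` and `m = 6γ s₁ + 2`, both the
stay bound `√(32·2R·C_Ω(2R)^q) ξ₀⁻¹ e^{−(1−2γ)S} = K₃/R` and the exit bound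
`((e^{3γS} − 1)/(3γ)) · √(R^{−m}) / (κR/4) ≤ 4/(3γκR²)` are `≤ v₀/4` for `R` large. [folklore] -/
theorem race_arith {γ q CΩ ξ₀ v₀ κ : ℝ} (hγ : 0 < γ) (hγ2 : γ < 1 / 2) (hq : 0 ≤ q) (hC : 0 ≤ CΩ)
    (hξ₀ : 0 < ξ₀) (hv₀ : 0 < v₀) (hκ : 0 < κ) :
    ∃ s₁ m Rstar : ℝ, 0 < s₁ ∧ 1 ≤ Rstar ∧ ∀ R : ℝ, Rstar ≤ R →
      Real.sqrt (32 * (2 * R) * (CΩ * (2 * R) ^ q)) / ξ₀ *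
          Real.exp (-((1 - 2 * γ) * (s₁ * Real.log R))) ≤ v₀ / 4 ∧
      (Real.exp (3 * γ * (s₁ * Real.log R)) - 1) / (3 * γ) * Real.sqrt (R ^ (-m)) / (κ * R / 4) ≤
        v₀ / 4 := by
  have h12γ : 0 < 1 - 2 * γ := by linarith
  -- `√(exp x) = exp (x/2)` (kept local: the tree's copy lives in an unrelated sieve module)
  have sqrt_exp : ∀ x : ℝ, Real.sqrt (Real.exp x) = Real.exp (x / 2) := fun x => by
    rw [show Real.exp x = Real.exp (x / 2) ^ 2 by rw [sq, ← Real.exp_add]; congr 1; ring]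
    exact Real.sqrt_sq (Real.exp_pos _).le
  set e : ℝ := (1 + q) / 2 with he
  have he0 : 0 < e := by rw [he]; linarith
  set s₁ : ℝ := (e + 1) / (1 - 2 * γ) with hs₁
  have hs₁0 : 0 < s₁ := by rw [hs₁]; positivity
  set m : ℝ := 6 * γ * s₁ + 2 with hm
  -- the stay constant
  set K₃ : ℝ := Real.sqrt (32 * CΩ) * Real.exp (e * Real.log 2) / ξ₀ with hK₃
  have hK₃0 : 0 ≤ K₃ := by rw [hK₃]; positivity
  set Rstar : ℝ := max 1 (max (4 * K₃ / v₀) (16 / (3 * γ * κ * v₀))) with hRstar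
  refine ⟨s₁, m, Rstar, hs₁0, le_max_left _ _, fun R hR => ?_⟩
  have hR1 : 1 ≤ R := (le_max_left _ _).trans hR
  have hR0 : 0 < R := by linarith
  have hRa : 4 * K₃ / v₀ ≤ R := ((le_max_left _ _).trans (le_max_right _ _)).trans hR
  have hRb : 16 / (3 * γ * κ * v₀) ≤ R := ((le_max_right _ _).trans (le_max_right _ _)).trans hR
  have hlogR : 0 ≤ Real.log R := Real.log_nonneg hR1
  have h2R : 0 < 2 * R := by positivity
  constructor
  · -- STAY: `√(32·2R·CΩ(2R)^q)/ξ₀ · e^{−(1−2γ)s₁ log R} = K₃ / R ≤ v₀/4`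
    have hpow : (2 * R) ^ q = Real.exp (q * Real.log (2 * R)) := by
      rw [Real.rpow_def_of_pos h2R, mul_comm]
    have hin : 32 * (2 * R) * (CΩ * (2 * R) ^ q) = 32 * CΩ * Real.exp ((1 + q) * Real.log (2 * R)) := by
      have h1 : (2 * R) * Real.exp (q * Real.log (2 * R)) = Real.exp ((1 + q) * Real.log (2 * R)) := by
        rw [add_mul, one_mul, Real.exp_add, Real.exp_log h2R]
      calc 32 * (2 * R) * (CΩ * (2 * R) ^ q)
          = 32 * CΩ * ((2 * R) * Real.exp (q * Real.log (2 * R))) := by rw [hpow]; ring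
        _ = 32 * CΩ * Real.exp ((1 + q) * Real.log (2 * R)) := by rw [h1]
    have hsq : Real.sqrt (32 * (2 * R) * (CΩ * (2 * R) ^ q)) =
        Real.sqrt (32 * CΩ) * Real.exp (e * Real.log (2 * R)) := by
      rw [hin, Real.sqrt_mul (by positivity), sqrt_exp]
      congr 2
      rw [he]; ring
    have hlog2R : Real.log (2 * R) = Real.log 2 + Real.log R :=
      Real.log_mul (by norm_num) hR0.ne'
    have hexpS : Real.exp (-((1 - 2 * γ) * (s₁ * Real.log R))) = Real.exp (-((e + 1) * Real.log R)) := by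
      congr 1
      rw [hs₁]; field_simp
    have hval : Real.sqrt (32 * (2 * R) * (CΩ * (2 * R) ^ q)) / ξ₀ *
        Real.exp (-((1 - 2 * γ) * (s₁ * Real.log R))) = K₃ / R := by
      rw [hsq, hexpS, hlog2R, hK₃, eq_div_iff hR0.ne']
      have hR' : Real.exp (Real.log R) = R := Real.exp_log hR0
      calc Real.sqrt (32 * CΩ) * Real.exp (e * (Real.log 2 + Real.log R)) / ξ₀ *
            Real.exp (-((e + 1) * Real.log R)) * R
          = Real.sqrt (32 * CΩ) / ξ₀ * (Real.exp (e * (Real.log 2 + Real.log R)) *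
              Real.exp (-((e + 1) * Real.log R)) * Real.exp (Real.log R)) := by rw [hR']; ring
        _ = Real.sqrt (32 * CΩ) / ξ₀ * Real.exp (e * Real.log 2) := by
            rw [← Real.exp_add, ← Real.exp_add]
            congr 1
            congr 1; ring
        _ = Real.sqrt (32 * CΩ) * Real.exp (e * Real.log 2) / ξ₀ := by ring
    rw [hval, div_le_iff₀ hR0]
    rw [div_le_iff₀ hv₀] at hRa
    linarith
  · -- EXIT: `((e^{3γS} − 1)/(3γ)) √(R^{−m}) / (κR/4) ≤ (4/(3γκ)) /R² ≤ v₀/4`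
    have h3γ : 0 < 3 * γ := by positivity
    have hcS : (Real.exp (3 * γ * (s₁ * Real.log R)) - 1) / (3 * γ) ≤
        Real.exp (3 * γ * s₁ * Real.log R) / (3 * γ) := by
      rw [show 3 * γ * (s₁ * Real.log R) = 3 * γ * s₁ * Real.log R by ring]
      exact div_le_div_of_nonneg_right (by linarith) h3γ.le
    have hsqrt : Real.sqrt (R ^ (-m)) = Real.exp (-(m / 2) * Real.log R) := by
      rw [Real.rpow_def_of_pos hR0, sqrt_exp]
      congr 1; ring
    have hprod : Real.exp (3 * γ * s₁ * Real.log R) / (3 * γ) * Real.exp (-(m / 2) * Real.log R) =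
        1 / (3 * γ * R) := by
      rw [div_mul_eq_mul_div, ← Real.exp_add,
        show 3 * γ * s₁ * Real.log R + -(m / 2) * Real.log R = -Real.log R by rw [hm]; ring,
        Real.exp_neg, Real.exp_log hR0]
      field_simp
    have hcS0 : 0 ≤ (Real.exp (3 * γ * (s₁ * Real.log R)) - 1) / (3 * γ) := by
      apply div_nonneg _ h3γ.le
      have : 1 ≤ Real.exp (3 * γ * (s₁ * Real.log R)) := Real.one_le_exp (by positivity)
      linarith
    have hκR : 0 < κ * R / 4 := by positivity
    have hstep : (Real.exp (3 * γ * (s₁ * Real.log R)) - 1) / (3 * γ) * Real.sqrt (R ^ (-m)) ≤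
        1 / (3 * γ * R) := by
      rw [hsqrt, ← hprod]
      exact mul_le_mul_of_nonneg_right hcS (Real.exp_pos _).le
    have hfin : 1 / (3 * γ * R) / (κ * R / 4) ≤ v₀ / 4 := by
      rw [div_div_eq_mul_div, div_le_iff₀ (by positivity)]
      -- `4/(3γR) ≤ v₀ κ R /4`, from `16/(3γκv₀) ≤ R` and `R ≥ 1`
      rw [div_le_iff₀ (by positivity)] at hRb
      have h1 : 1 / (3 * γ * R) * 4 = 4 / (3 * γ * R) := by ring
      rw [h1, div_le_iff₀ (by positivity)]
      have hRR : R ≤ R * R := by nlinarith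
      nlinarith [mul_pos (mul_pos h3γ hκ) hv₀, hRR]
    exact (div_le_div_of_nonneg_right hstep hκR.le).trans hfin

end Summit.NavierStokesRegularity.NavierStokesRegularity.Theorems.PowerGaugeEulerLiouville.NeedleRace

end
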